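import Mathlib
import Summits.Ventures.HodgeRepro2.BallQuotientCompactTransfer
import Summits.Ventures.HodgeRepro2.PeterssonCompactQuotient

/-!
# FundamentalDomainUnfolding — the integral of an invariant function over a compact set is
bounded by a multiple of its integral over a fundamental domain

Blind cell `pub-hodge-repro2`, seat p2 (Tier 5 kernel support: towards the finite-dimensionality
of the holomorphic weight-`k` forms).

* `lintegral_restrict_le_of_invariant` (Mathlib-level): for a group `G` acting on `(α, μ)` by
  measure-preserving maps, a fundamental domain `s`, a measurable set `t`, and a `G`-invariant
  measurable `φ : α → ℝ≥0∞`, if every orbit meets `t` at most `N` times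
  (`∑' g, t.indicator 1 (g • x) ≤ N`), then `∫⁻_t φ ≤ N · ∫⁻_s φ` (the unfolding
  `IsFundamentalDomain.lintegral_eq_tsum''`).
* `setIntegral_petersson_le_card_mul` (the ball): for a compact quotient `S\𝔹²`, a compact
  `t ⊂ 𝔹²`, a measurable fundamental domain `D` and a continuous weight-`k` form `f`, the
  integral of the Petersson density `petersson k f` over `t` is at most `N_t` times the Petersson
  norm `∫_D petersson k f dμ_B`, where `N_t = #{γ ∈ S | γ·C₀ ∩ t ≠ ∅}` for a compact `C₀` with
  `S·C₀ = 𝔹²` (`BallQuotientCompactTransfer.exists_isCompact_image_mk_eq_univ`; finiteness by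
  proper discontinuity, `ProperlyDiscontinuousSMul.finite_disjoint_inter_image`).
-/

namespace Summit.Ventures.HodgeRepro2.FundamentalDomainUnfolding

open MeasureTheory Set
open scoped ENNReal

section general

variable {G α : Type*} [Group G] [MulAction G α] [MeasurableSpace α] [MeasurableConstSMul G α]
  {μ : Measure α} [SMulInvariantMeasure G α μ] [Countable G]

/-- **Unfolding bound.** For a fundamental domain `s`, a measurable `t`, an invariant measurable
`φ : α → ℝ≥0∞`, and a uniform bound `N` on the number of orbit points in `t`,
`∫⁻_t φ ≤ N · ∫⁻_s φ`. -/
theorem lintegral_restrict_le_of_invariant {s : Set α} (hs : IsFundamentalDomain G s μ) {t : Set α}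
    (ht : MeasurableSet t) {φ : α → ℝ≥0∞} (hφ : Measurable φ) (hinv : ∀ (g : G) (x : α), φ (g • x) = φ x)
    {N : ℝ≥0∞} (hN : ∀ x : α, ∑' g : G, t.indicator (1 : α → ℝ≥0∞) (g • x) ≤ N) :
    ∫⁻ x in t, φ x ∂μ ≤ N * ∫⁻ x in s, φ x ∂μ := by
  have h1 : ∫⁻ x in t, φ x ∂μ = ∫⁻ x, t.indicator φ x ∂μ := (lintegral_indicator ht φ).symm
  have h2 : ∀ (g : G) (x : α), t.indicator φ (g • x) = t.indicator (1 : α → ℝ≥0∞) (g • x) * φ x := by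
    intro g x
    by_cases hx : g • x ∈ t
    · simp [indicator_of_mem hx, hinv]
    · simp [indicator_of_notMem hx]
  rw [h1, hs.lintegral_eq_tsum'' (t.indicator φ)]
  simp_rw [h2]
  have hmeas : ∀ g : G, AEMeasurable (fun x => t.indicator (1 : α → ℝ≥0∞) (g • x) * φ x)
      (μ.restrict s) := fun g =>
    ((measurable_one.indicator ht).comp (measurable_const_smul g)).aemeasurable.mul hφ.aemeasurable
  rw [← lintegral_tsum hmeas]
  calc ∫⁻ x in s, ∑' g : G, t.indicator (1 : α → ℝ≥0∞) (g • x) * φ x ∂μ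
      = ∫⁻ x in s, (∑' g : G, t.indicator (1 : α → ℝ≥0∞) (g • x)) * φ x ∂μ := by
        congr 1
        funext x
        rw [ENNReal.tsum_mul_right]
    _ ≤ ∫⁻ x in s, N * φ x ∂μ := by
        refine lintegral_mono fun x => ?_
        exact mul_le_mul' (hN x) le_rfl
    _ = N * ∫⁻ x in s, φ x ∂μ := lintegral_const_mul N hφ

omit [MeasurableSpace α] [MeasurableConstSMul G α] [Countable G] in
/-- The orbit count `∑' g, t.indicator 1 (g • x)` is bounded by the number of group elements
moving a set `C₀` (which meets every orbit) into `t`. -/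
theorem tsum_indicator_smul_le {C₀ t : Set α} (hC₀ : ∀ x : α, ∃ u ∈ C₀, ∃ g : G, g • u = x)
    (hfin : {g : G | ((fun y => g • y) '' C₀ ∩ t).Nonempty}.Finite) (x : α) :
    ∑' g : G, t.indicator (1 : α → ℝ≥0∞) (g • x) ≤ (hfin.toFinset.card : ℝ≥0∞) := by
  obtain ⟨u, hu, g₀, rfl⟩ := hC₀ x
  -- reindex by `g ↦ g * g₀`
  have hre : ∑' g : G, t.indicator (1 : α → ℝ≥0∞) (g • g₀ • u)
      = ∑' g : G, t.indicator (1 : α → ℝ≥0∞) (g • u) := by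
    rw [← (Equiv.mulRight g₀).tsum_eq (fun g => t.indicator (1 : α → ℝ≥0∞) (g • u))]
    simp only [Equiv.coe_mulRight, mul_smul]
  rw [hre]
  calc ∑' g : G, t.indicator (1 : α → ℝ≥0∞) (g • u)
      ≤ ∑' g : G, ({g : G | ((fun y => g • y) '' C₀ ∩ t).Nonempty}).indicator
          (1 : G → ℝ≥0∞) g := by
        refine ENNReal.tsum_le_tsum fun g => ?_
        by_cases hg : g • u ∈ t
        · have : g ∈ {g : G | ((fun y => g • y) '' C₀ ∩ t).Nonempty} :=
            ⟨g • u, ⟨u, hu, rfl⟩, hg⟩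
          rw [indicator_of_mem hg, indicator_of_mem this, Pi.one_apply, Pi.one_apply]
        · rw [indicator_of_notMem hg]
          exact zero_le
    _ = ∑ g ∈ hfin.toFinset, (1 : ℝ≥0∞) := by
        rw [tsum_eq_sum (s := hfin.toFinset) (fun g hg => ?_)]
        · refine Finset.sum_congr rfl fun g hg => ?_
          rw [Finite.mem_toFinset] at hg
          rw [indicator_of_mem hg, Pi.one_apply]
        · rw [Finite.mem_toFinset] at hg
          rw [indicator_of_notMem hg]
    _ = (hfin.toFinset.card : ℝ≥0∞) := by simp

end general

end Summit.Ventures.HodgeRepro2.FundamentalDomainUnfolding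

namespace Summit.Ventures.HodgeRepro2.ShimuraData

open MeasureTheory Set FundamentalDomainUnfolding
open scoped ENNReal

variable {K : Type*} [Field K] [NumberField K] [NumberField.IsCMField K] {τ₁ : K →+* ℂ}
  {H : Matrix (Fin 3) (Fin 3) K} {Q : Matrix (Fin 3) (Fin 3) ℂ} (hQ : IsFrame K τ₁ H Q)
  (S : Subgroup (GL (Fin 3) K)) (hS : (S : Set (GL (Fin 3) K)) ⊆ unitaryGroup K H)

/-- Every point of the ball is a translate of a point of a set `C₀` with `mk '' C₀ = univ`. -/
theorem exists_mem_smul_eq_of_image_mk_eq_univ {C₀ : Set ball₂}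
    (hC₀ : ballQuotient.mk hQ S hS '' C₀ = univ) (x : ball₂) :
    letI := frameAction hQ S hS
    ∃ u ∈ C₀, ∃ γ : S, γ • u = x := by
  letI := frameAction hQ S hS
  have hx : ballQuotient.mk hQ S hS x ∈ ballQuotient.mk hQ S hS '' C₀ := by
    rw [hC₀]; exact mem_univ _
  obtain ⟨u, hu, hux⟩ := hx
  rw [ballQuotient_mk_eq_mk_iff] at hux
  obtain ⟨γ, hγ⟩ := hux
  have hγ' : γ • x = u := Subtype.ext (by rw [frameAction_smul_coe]; exact hγ)
  exact ⟨u, hu, γ⁻¹, by rw [← hγ', inv_smul_smul]⟩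

/-- **The unfolding bound on the ball**: for a compact quotient, a compact `t ⊂ 𝔹²`, a
fundamental domain `D` and a continuous weight-`k` form `f`, the Petersson density integrates
over `t` to at most `N_t` times the Petersson norm, where `N_t` depends only on `t`, `S` and a
compact `C₀` with `S·C₀ = 𝔹²` (not on `f`). -/
theorem exists_card_setIntegral_petersson_le [CompactSpace (ballQuotient hQ S hS)]
    (hpd : @ProperlyDiscontinuousSMul S ball₂ _ (frameAction hQ S hS).toSMul) {t : Set ball₂}
    (ht : IsCompact t) {D : Set ball₂} (hD : IsBallFundamentalDomain hQ S hS D) :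
    ∃ N : ℕ, ∀ {k : ℕ} {f : (Fin 2 → ℂ) → ℂ}, IsWeightFor τ₁ Q S k f → ContinuousOn f ball₂ →
      ∫ z in t, petersson k f (z : Fin 2 → ℂ) ∂bergmanBall
        ≤ N * ∫ z in D, petersson k f (z : Fin 2 → ℂ) ∂bergmanBall := by
  letI := frameAction hQ S hS
  haveI := hpd
  haveI := measurableConstSMul_frameAction hQ S hS
  haveI := smulInvariantMeasure_bergmanBall hQ S hS
  haveI := countable_subgroup_GL_of_numberField S
  obtain ⟨C₀, hC₀c, hC₀⟩ := exists_isCompact_image_mk_eq_univ hQ S hS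
  have hfin : {γ : S | ((fun y => γ • y) '' C₀ ∩ t).Nonempty}.Finite :=
    ProperlyDiscontinuousSMul.finite_disjoint_inter_image hC₀c ht
  refine ⟨hfin.toFinset.card, ?_⟩
  intro k f hf hfc
  -- the Petersson density as an `ℝ≥0∞`-valued invariant function on the ball
  set φ : ball₂ → ℝ≥0∞ := fun z => ENNReal.ofReal (petersson k f (z : Fin 2 → ℂ)) with hφdef
  have hcont : ContinuousOn (fun z : ball₂ => petersson k f (z : Fin 2 → ℂ)) univ := by
    refine (continuousOn_petersson k hfc).comp continuous_subtype_val.continuousOn ?_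
    intro z _
    exact z.2
  have hφm : Measurable φ := by
    refine ENNReal.measurable_ofReal.comp ?_
    exact (continuousOn_univ.mp hcont).measurable
  have hinv : ∀ (γ : S) (z : ball₂), φ (γ • z) = φ z := fun γ z => by
    simp only [hφdef, petersson_frameAction_smul hQ S hS hf γ z]
  have hN : ∀ x : ball₂, ∑' γ : S, t.indicator (1 : ball₂ → ℝ≥0∞) (γ • x)
      ≤ (hfin.toFinset.card : ℝ≥0∞) :=
    tsum_indicator_smul_le (fun x => exists_mem_smul_eq_of_image_mk_eq_univ hQ S hS hC₀ x) hfin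
  have hmain := lintegral_restrict_le_of_invariant (μ := bergmanBall) hD ht.measurableSet hφm hinv hN
  -- the Petersson density is bounded on the ball (invariance + compactness of `C₀`)
  obtain ⟨M, hM⟩ := hC₀c.exists_bound_of_continuousOn (hcont.mono (subset_univ _))
  have hbound : ∀ z : ball₂, petersson k f (z : Fin 2 → ℂ) ≤ M := by
    intro z
    obtain ⟨u, hu, γ, rfl⟩ := exists_mem_smul_eq_of_image_mk_eq_univ hQ S hS hC₀ z
    have := hM u hu
    rw [Real.norm_eq_abs, abs_of_nonneg (petersson_nonneg k f u.2)] at this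
    calc petersson k f ((γ • u : ball₂) : Fin 2 → ℂ) = petersson k f (u : Fin 2 → ℂ) :=
          petersson_frameAction_smul hQ S hS hf γ u
      _ ≤ M := this
  have hnn : ∀ z : ball₂, 0 ≤ petersson k f (z : Fin 2 → ℂ) := fun z => petersson_nonneg k f z.2
  have hDfin : bergmanBall D < ⊤ := bergmanBall_lt_top_of_compactSpace hQ S hS hD
  -- finiteness of the right-hand side
  have hRfin : ∫⁻ z in D, φ z ∂bergmanBall < ⊤ := by
    calc ∫⁻ z in D, φ z ∂bergmanBall ≤ ∫⁻ _ in D, ENNReal.ofReal M ∂bergmanBall :=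
          lintegral_mono fun z => ENNReal.ofReal_le_ofReal (hbound z)
      _ = ENNReal.ofReal M * bergmanBall D := by rw [lintegral_const, Measure.restrict_apply_univ]
      _ < ⊤ := ENNReal.mul_lt_top ENNReal.ofReal_lt_top hDfin
  -- pass to Bochner integrals
  have hae : AEStronglyMeasurable (fun z : ball₂ => petersson k f (z : Fin 2 → ℂ)) bergmanBall :=
    (continuousOn_univ.mp hcont).aestronglyMeasurable
  rw [integral_eq_lintegral_of_nonneg_ae (Filter.Eventually.of_forall hnn) hae.restrict,
    integral_eq_lintegral_of_nonneg_ae (Filter.Eventually.of_forall hnn) hae.restrict]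
  have hN' : ((hfin.toFinset.card : ℕ) : ℝ) = (((hfin.toFinset.card : ℕ) : ℝ≥0∞)).toReal := by
    simp
  rw [hN', ← ENNReal.toReal_mul]
  exact ENNReal.toReal_mono (ENNReal.mul_ne_top (ENNReal.natCast_ne_top _) hRfin.ne) hmain

end Summit.Ventures.HodgeRepro2.ShimuraData
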